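import Summits.Ventures.YMGap.RobustBall.BoundaryFactorLipschitz
import Summits.Ventures.YMGap.RobustBall.KernelClusteringBall
import HarnessLib

/-!
# Venture YMGap, track ROBUST-BALL — «C-DS-II» CELL: THE DOBRUSHIN–SHLOSMAN CONDITION-II SHAPE FOR `SU(2)` LATTICE YANG–MILLS ON `ℤ⁴`,
# EVERY `0 ≤ β_W ≤ 1/12` — mixed boundary differences of the free energy decay like `2^{−dist}`, uniformly in the volume and the boundary

HONEST FRAMING. WHAT THIS IS: a venture file (cell `pub-ymgap`, track Y2 ROBUST-BALL / DS, seat ds-3, theorems only, 0 compute): the `SU(2)`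
cell of «C-DS-II» = door (`BoundaryFreeEnergyMixing.abs_mixedDifference_log_normaliser_le`) ∘ currency (`BoundaryFactorLipschitz`) ∘ the
seat's KERNEL CLUSTERING UNIFORM IN THE VOLUME AND THE BOUNDARY FIELD (`KernelClusteringBall.su2_wilson_kernel_clustering_upTo_oneTwelfth`,
the single-link Kantorovich door — valid for ALL Lipschitz cylinders, in particular those sitting AT the boundary).
★★★ `su2_abs_mixedDifference_log_normaliser_le` — `SU(2)`, `d = 4`, Wilson action at tree coupling `β_W/2`, EVERY `0 ≤ β_W ≤ 1/12`: for EVERY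
finite link volume `Λ`, EVERY boundary field `η`, modifications `η₁` (on `B₁`), `η₂` (on `B₂`), `η₁₂` (both) such that no plaquette touching `Λ`
meets both `B₁` and `B₂`, with `Pᵢ = {p ∈ T(Λ) : p ∩ Bᵢ ≠ ∅}`, `Δᵢ =` the links of `Pᵢ`:
`|log Z_Λ(η₁₂) − log Z_Λ(η₁) − log Z_Λ(η₂) + log Z_Λ(η)| ≤ e^{2β_W(#P₁+#P₂)} · 32 · #Δ₁ · #Δ₂ · K₁K₂ · 2^{−dist_∞(Δ₁, Δ₂)}`,
`Kᵢ = 64 β_W e^{2β_W #Pᵢ} #Pᵢ` — the effect on the free energy of changing the boundary field at two places FACTORISES up to an error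
exponentially small in their separation, with ONE rate (`log 2` per lattice unit) and constants polynomial in the sizes of the modifications,
for ALL finite volumes and ALL boundary fields: the Dobrushin–Shlosman complete-analyticity Condition-II shape at strong coupling, far
beyond the cluster-expansion radius.
★★ `su2_abs_mixedDifference_log_normaliser_le_lt_oneSixth` — the rest of the single-link window, `1/12 ≤ β_W < 1/6`, rate `(6β_W)^{dist}`.
WHAT THIS IS NOT: real couplings only (no analyticity statement); the window is the single-link door's `β_W < 1/6`, NOT the vertex-star window `9/25` — the star kernel clustering of `StarKernelClusteringZd` is an INTERIOR
statement and says nothing about factors at the boundary; lattice, nothing continuum / Clay.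
References: R. L. Dobrushin, S. B. Shlosman, J. Stat. Phys. 46 (1987) 983–1014, Condition II (statement shape); everything here is proved.
[folklore]
-/

noncomputable section

open MeasureTheory ProbabilityTheory Filter Topology Real Finset Set
open scoped NNReal
open Literature.Probability.LatticeModels hiding configShift configShift_apply
open Literature.MathematicalPhysics.QuantumLattice
open Literature.MathematicalPhysics.QuantumFieldTheory (IsLipschitzCylinder setDistEdges haarProbability)

namespace Summit.Ventures.YMGap.RobustBall

namespace BoundaryFreeEnergy

/-- ★★★ **«C-DS-II» FOR `SU(2)` ON `ℤ⁴`, EVERY `0 ≤ β_W ≤ 1/12`: MIXED BOUNDARY DIFFERENCES OF THE FREE ENERGY DECAY LIKE `2^{−dist}`,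
UNIFORMLY IN THE VOLUME AND THE BOUNDARY FIELD.** See the module docstring for the reading; `Pᵢ = {p ∈ T(Λ) : p ∩ Bᵢ ≠ ∅}`, `Δᵢ` their links,
`dist = setDistEdges Δ₁ Δ₂` (sup-norm distance of base points). [folklore] -/
theorem su2_abs_mixedDifference_log_normaliser_le {βW : ℝ} (h0 : 0 ≤ βW) (h : βW ≤ 1 / 12)
    (Λ B₁ B₂ : Finset (ZdEdge 4)) {η η₁ η₂ η₁₂ : LGConfig 4 (SUN 2)}
    (hη₁ : ∀ e, e ∉ B₁ → η₁ e = η e) (hη₂ : ∀ e, e ∉ B₂ → η₂ e = η e)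
    (h₁₂B₁ : ∀ e ∈ B₁, η₁₂ e = η₁ e) (h₁₂B₂ : ∀ e ∈ B₂, η₁₂ e = η₂ e) (h₁₂ : ∀ e, e ∉ B₁ → e ∉ B₂ → η₁₂ e = η e)
    (hsep : ∀ p ∈ plaquettesTouching Λ, (plaquetteEdges p ∩ B₁).Nonempty → ¬(plaquetteEdges p ∩ B₂).Nonempty) :
    |Real.log (∫ ζ, Real.exp (-(βW / 2) * wilsonBoundaryAction (fundamentalRep (Fin 2)) Λ (glueWith Λ ζ η₁₂))
          ∂(Measure.pi fun _ : ↥Λ => haarProbability (SUN 2))) -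
        Real.log (∫ ζ, Real.exp (-(βW / 2) * wilsonBoundaryAction (fundamentalRep (Fin 2)) Λ (glueWith Λ ζ η₁))
          ∂(Measure.pi fun _ : ↥Λ => haarProbability (SUN 2))) -
        Real.log (∫ ζ, Real.exp (-(βW / 2) * wilsonBoundaryAction (fundamentalRep (Fin 2)) Λ (glueWith Λ ζ η₂))
          ∂(Measure.pi fun _ : ↥Λ => haarProbability (SUN 2))) +
        Real.log (∫ ζ, Real.exp (-(βW / 2) * wilsonBoundaryAction (fundamentalRep (Fin 2)) Λ (glueWith Λ ζ η))
          ∂(Measure.pi fun _ : ↥Λ => haarProbability (SUN 2)))| ≤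
      Real.exp (2 * βW * (((plaquettesTouching Λ).filter (fun p => (plaquetteEdges p ∩ B₁).Nonempty)).card +
          ((plaquettesTouching Λ).filter (fun p => (plaquetteEdges p ∩ B₂).Nonempty)).card)) *
        (32 * (((plaquettesTouching Λ).filter (fun p => (plaquetteEdges p ∩ B₁).Nonempty)).biUnion plaquetteEdges).card *
          (((plaquettesTouching Λ).filter (fun p => (plaquetteEdges p ∩ B₂).Nonempty)).biUnion plaquetteEdges).card *
          ((64 * βW * Real.exp (2 * βW * ((plaquettesTouching Λ).filter (fun p => (plaquetteEdges p ∩ B₁).Nonempty)).card) *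
              ((plaquettesTouching Λ).filter (fun p => (plaquetteEdges p ∩ B₁).Nonempty)).card) *
            (64 * βW * Real.exp (2 * βW * ((plaquettesTouching Λ).filter (fun p => (plaquetteEdges p ∩ B₂).Nonempty)).card) *
              ((plaquettesTouching Λ).filter (fun p => (plaquetteEdges p ∩ B₂).Nonempty)).card)) *
          Real.exp (-Real.log 2 * setDistEdges
            (((plaquettesTouching Λ).filter (fun p => (plaquetteEdges p ∩ B₁).Nonempty)).biUnion plaquetteEdges)
            (((plaquettesTouching Λ).filter (fun p => (plaquetteEdges p ∩ B₂).Nonempty)).biUnion plaquetteEdges))) := by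
  set P₁ := (plaquettesTouching Λ).filter (fun p => (plaquetteEdges p ∩ B₁).Nonempty) with hP₁
  set P₂ := (plaquettesTouching Λ).filter (fun p => (plaquetteEdges p ∩ B₂).Nonempty) with hP₂
  set b : ℝ := βW / 2 with hb
  have hb0 : 0 ≤ b := by rw [hb]; linarith
  have hbabs : |b| = b := abs_of_nonneg hb0
  -- the currency: boundary factors are Lipschitz cylinders (N = 2: 2N = 4, 8N⁴ = 128)
  have hK : ∀ (P : Finset (ZdPlaquette 4)), 0 ≤ 64 * βW * Real.exp (2 * βW * P.card) * P.card := fun P => by positivity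
  set K₁ : ℝ≥0 := (64 * βW * Real.exp (2 * βW * P₁.card) * P₁.card).toNNReal with hK₁
  set K₂ : ℝ≥0 := (64 * βW * Real.exp (2 * βW * P₂.card) * P₂.card).toNNReal with hK₂
  have hK₁c : (K₁ : ℝ) = 64 * βW * Real.exp (2 * βW * P₁.card) * P₁.card := by rw [hK₁, Real.coe_toNNReal _ (hK P₁)]
  have hK₂c : (K₂ : ℝ) = 64 * βW * Real.exp (2 * βW * P₂.card) * P₂.card := by rw [hK₂, Real.coe_toNNReal _ (hK P₂)]
  have hKeq : ∀ (P : Finset (ZdPlaquette 4)),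
      |b| * Real.exp (|b| * (2 * (2 : ℕ) * P.card)) * (8 * ((2 : ℕ) : ℝ) ^ 4 * P.card) = 64 * βW * Real.exp (2 * βW * P.card) * P.card := by
    intro P; rw [hbabs, hb]; push_cast; ring_nf
  have hF₁ := suN_isLipschitzCylinder_boundaryFactor (N := 2) b Λ B₁ hη₁ (K := K₁) (by rw [hKeq P₁, hK₁c])
  have hF₂ := suN_isLipschitzCylinder_boundaryFactor (N := 2) b Λ B₂ hη₂ (K := K₂) (by rw [hKeq P₂, hK₂c])
  -- kernel clustering uniform in the volume and the boundary field (K2)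
  have hcov := su2_wilson_kernel_clustering_upTo_oneTwelfth h0 h Λ η hF₁ hF₂
  rw [show βW / 2 = b from rfl] at hcov
  -- the door
  have hD₁ := fun ζ : ↥Λ → SUN 2 => suN_abs_boundaryShift_le (N := 2) Λ B₁ hη₁ ζ
  have hD₂ := fun ζ : ↥Λ → SUN 2 => suN_abs_boundaryShift_le (N := 2) Λ B₂ hη₂ ζ
  have key := abs_mixedDifference_log_normaliser_le (fundamentalRep (Fin 2)) (continuous_fundamentalRep (Fin 2)) b Λ B₁ B₂
    hη₁ hη₂ h₁₂B₁ h₁₂B₂ h₁₂ hsep hD₁ hD₂ hcov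
  refine key.trans (le_of_eq ?_)
  rw [hbabs, hb, hK₁c, hK₂c]
  simp only [← hP₁, ← hP₂]
  push_cast
  ring_nf

/-- ★★ **«C-DS-II» FOR `SU(2)` ON `ℤ⁴`, THE REST OF THE SINGLE-LINK WINDOW `1/12 ≤ β_W < 1/6`**: the same mixed-difference bound with the
KR-door rate `(6β_W)^{dist}` and constant `16/(6β_W)` (the seat's `su2_wilson_kernel_clustering_lt_oneSixth`). [folklore] -/
theorem su2_abs_mixedDifference_log_normaliser_le_lt_oneSixth {βW : ℝ} (h0 : 1 / 12 ≤ βW) (h : βW < 1 / 6)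
    (Λ B₁ B₂ : Finset (ZdEdge 4)) {η η₁ η₂ η₁₂ : LGConfig 4 (SUN 2)}
    (hη₁ : ∀ e, e ∉ B₁ → η₁ e = η e) (hη₂ : ∀ e, e ∉ B₂ → η₂ e = η e)
    (h₁₂B₁ : ∀ e ∈ B₁, η₁₂ e = η₁ e) (h₁₂B₂ : ∀ e ∈ B₂, η₁₂ e = η₂ e) (h₁₂ : ∀ e, e ∉ B₁ → e ∉ B₂ → η₁₂ e = η e)
    (hsep : ∀ p ∈ plaquettesTouching Λ, (plaquetteEdges p ∩ B₁).Nonempty → ¬(plaquetteEdges p ∩ B₂).Nonempty) :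
    |Real.log (∫ ζ, Real.exp (-(βW / 2) * wilsonBoundaryAction (fundamentalRep (Fin 2)) Λ (glueWith Λ ζ η₁₂))
          ∂(Measure.pi fun _ : ↥Λ => haarProbability (SUN 2))) -
        Real.log (∫ ζ, Real.exp (-(βW / 2) * wilsonBoundaryAction (fundamentalRep (Fin 2)) Λ (glueWith Λ ζ η₁))
          ∂(Measure.pi fun _ : ↥Λ => haarProbability (SUN 2))) -
        Real.log (∫ ζ, Real.exp (-(βW / 2) * wilsonBoundaryAction (fundamentalRep (Fin 2)) Λ (glueWith Λ ζ η₂))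
          ∂(Measure.pi fun _ : ↥Λ => haarProbability (SUN 2))) +
        Real.log (∫ ζ, Real.exp (-(βW / 2) * wilsonBoundaryAction (fundamentalRep (Fin 2)) Λ (glueWith Λ ζ η))
          ∂(Measure.pi fun _ : ↥Λ => haarProbability (SUN 2)))| ≤
      Real.exp (2 * βW * (((plaquettesTouching Λ).filter (fun p => (plaquetteEdges p ∩ B₁).Nonempty)).card +
          ((plaquettesTouching Λ).filter (fun p => (plaquetteEdges p ∩ B₂).Nonempty)).card)) *
        (16 * (((plaquettesTouching Λ).filter (fun p => (plaquetteEdges p ∩ B₁).Nonempty)).biUnion plaquetteEdges).card *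
          (((plaquettesTouching Λ).filter (fun p => (plaquetteEdges p ∩ B₂).Nonempty)).biUnion plaquetteEdges).card *
          ((64 * βW * Real.exp (2 * βW * ((plaquettesTouching Λ).filter (fun p => (plaquetteEdges p ∩ B₁).Nonempty)).card) *
              ((plaquettesTouching Λ).filter (fun p => (plaquetteEdges p ∩ B₁).Nonempty)).card) *
            (64 * βW * Real.exp (2 * βW * ((plaquettesTouching Λ).filter (fun p => (plaquetteEdges p ∩ B₂).Nonempty)).card) *
              ((plaquettesTouching Λ).filter (fun p => (plaquetteEdges p ∩ B₂).Nonempty)).card)) *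
          ((6 * βW)⁻¹ * Real.exp (-(-Real.log (6 * βW)) * setDistEdges
            (((plaquettesTouching Λ).filter (fun p => (plaquetteEdges p ∩ B₁).Nonempty)).biUnion plaquetteEdges)
            (((plaquettesTouching Λ).filter (fun p => (plaquetteEdges p ∩ B₂).Nonempty)).biUnion plaquetteEdges)))) := by
  set P₁ := (plaquettesTouching Λ).filter (fun p => (plaquetteEdges p ∩ B₁).Nonempty) with hP₁
  set P₂ := (plaquettesTouching Λ).filter (fun p => (plaquetteEdges p ∩ B₂).Nonempty) with hP₂
  set b : ℝ := βW / 2 with hb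
  have hb0 : 0 ≤ b := by rw [hb]; linarith
  have hbabs : |b| = b := abs_of_nonneg hb0
  -- the currency: boundary factors are Lipschitz cylinders (N = 2: 2N = 4, 8N⁴ = 128)
  have hK : ∀ (P : Finset (ZdPlaquette 4)), 0 ≤ 64 * βW * Real.exp (2 * βW * P.card) * P.card := fun P => by positivity
  set K₁ : ℝ≥0 := (64 * βW * Real.exp (2 * βW * P₁.card) * P₁.card).toNNReal with hK₁
  set K₂ : ℝ≥0 := (64 * βW * Real.exp (2 * βW * P₂.card) * P₂.card).toNNReal with hK₂
  have hK₁c : (K₁ : ℝ) = 64 * βW * Real.exp (2 * βW * P₁.card) * P₁.card := by rw [hK₁, Real.coe_toNNReal _ (hK P₁)]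
  have hK₂c : (K₂ : ℝ) = 64 * βW * Real.exp (2 * βW * P₂.card) * P₂.card := by rw [hK₂, Real.coe_toNNReal _ (hK P₂)]
  have hKeq : ∀ (P : Finset (ZdPlaquette 4)),
      |b| * Real.exp (|b| * (2 * (2 : ℕ) * P.card)) * (8 * ((2 : ℕ) : ℝ) ^ 4 * P.card) = 64 * βW * Real.exp (2 * βW * P.card) * P.card := by
    intro P; rw [hbabs, hb]; push_cast; ring_nf
  have hF₁ := suN_isLipschitzCylinder_boundaryFactor (N := 2) b Λ B₁ hη₁ (K := K₁) (by rw [hKeq P₁, hK₁c])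
  have hF₂ := suN_isLipschitzCylinder_boundaryFactor (N := 2) b Λ B₂ hη₂ (K := K₂) (by rw [hKeq P₂, hK₂c])
  -- kernel clustering uniform in the volume and the boundary field (K2)
  have hcov := su2_wilson_kernel_clustering_lt_oneSixth h0 h Λ η hF₁ hF₂
  rw [show βW / 2 = b from rfl] at hcov
  -- the door
  have hD₁ := fun ζ : ↥Λ → SUN 2 => suN_abs_boundaryShift_le (N := 2) Λ B₁ hη₁ ζ
  have hD₂ := fun ζ : ↥Λ → SUN 2 => suN_abs_boundaryShift_le (N := 2) Λ B₂ hη₂ ζ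
  have key := abs_mixedDifference_log_normaliser_le (fundamentalRep (Fin 2)) (continuous_fundamentalRep (Fin 2)) b Λ B₁ B₂
    hη₁ hη₂ h₁₂B₁ h₁₂B₂ h₁₂ hsep hD₁ hD₂ hcov
  refine key.trans (le_of_eq ?_)
  rw [hbabs, hb, hK₁c, hK₂c]
  simp only [← hP₁, ← hP₂]
  push_cast
  ring_nf

/-! ### Every `N ≥ 2`, every `d`: the Bakry–Émery single-link door -/

/-- ★★ **«C-DS-II» FOR EVERY `N ≥ 2` AND EVERY `d ≥ 1`** (Wilson action, 't Hooft `|β|` with `2(d−1)|β| < 1/2`, tree coupling `N β`, ratio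
`max(ρ,½)` for any `6(d−1)|β|/(½ − 2(d−1)|β|) ≤ ρ < 1` — rb-p1's hypothesis-free Bakry–Émery door through the seat's
`suN_kernel_covariance_decay_bakryEmery`): for every finite `Λ`, every boundary field and separated modifications as above,
`|log Z_Λ(η₁₂) − log Z_Λ(η₁) − log Z_Λ(η₂) + log Z_Λ(η)| ≤ e^{2N²|β|(#P₁+#P₂)} · 8N · #Δ₁ · #Δ₂ · K₁K₂ · max(ρ,½)^{−1} · max(ρ,½)^{dist_∞(Δ₁,Δ₂)}`,
`Kᵢ = N|β| e^{2N²|β|#Pᵢ} · 8N⁴ #Pᵢ`. [folklore] -/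
theorem suN_abs_mixedDifference_log_normaliser_le {d N : ℕ} (hd : 1 ≤ d) (hN : 2 ≤ N) {β ρ : ℝ}
    (hb : |β| * (2 * ((d : ℝ) - 1)) < 1 / 2)
    (hρ : 6 * ((d : ℝ) - 1) * |β| / (1 / 2 - |β| * (2 * ((d : ℝ) - 1))) ≤ ρ) (hρ1 : ρ < 1) [DecidableEq (ZdEdge d)]
    (Λ B₁ B₂ : Finset (ZdEdge d)) {η η₁ η₂ η₁₂ : LGConfig d (SUN N)}
    (hη₁ : ∀ e, e ∉ B₁ → η₁ e = η e) (hη₂ : ∀ e, e ∉ B₂ → η₂ e = η e)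
    (h₁₂B₁ : ∀ e ∈ B₁, η₁₂ e = η₁ e) (h₁₂B₂ : ∀ e ∈ B₂, η₁₂ e = η₂ e) (h₁₂ : ∀ e, e ∉ B₁ → e ∉ B₂ → η₁₂ e = η e)
    (hsep : ∀ p ∈ plaquettesTouching Λ, (plaquetteEdges p ∩ B₁).Nonempty → ¬(plaquetteEdges p ∩ B₂).Nonempty) :
    |Real.log (∫ ζ, Real.exp (-(N * β) * wilsonBoundaryAction (fundamentalRep (Fin N)) Λ (glueWith Λ ζ η₁₂))
          ∂(Measure.pi fun _ : ↥Λ => haarProbability (SUN N))) -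
        Real.log (∫ ζ, Real.exp (-(N * β) * wilsonBoundaryAction (fundamentalRep (Fin N)) Λ (glueWith Λ ζ η₁))
          ∂(Measure.pi fun _ : ↥Λ => haarProbability (SUN N))) -
        Real.log (∫ ζ, Real.exp (-(N * β) * wilsonBoundaryAction (fundamentalRep (Fin N)) Λ (glueWith Λ ζ η₂))
          ∂(Measure.pi fun _ : ↥Λ => haarProbability (SUN N))) +
        Real.log (∫ ζ, Real.exp (-(N * β) * wilsonBoundaryAction (fundamentalRep (Fin N)) Λ (glueWith Λ ζ η))
          ∂(Measure.pi fun _ : ↥Λ => haarProbability (SUN N)))| ≤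
      Real.exp (|N * β| * (2 * N * ((plaquettesTouching Λ).filter (fun p => (plaquetteEdges p ∩ B₁).Nonempty)).card +
          2 * N * ((plaquettesTouching Λ).filter (fun p => (plaquetteEdges p ∩ B₂).Nonempty)).card)) *
        (2 * (2 * Real.sqrt N) ^ 2 *
          (((plaquettesTouching Λ).filter (fun p => (plaquetteEdges p ∩ B₁).Nonempty)).biUnion plaquetteEdges).card *
          (((plaquettesTouching Λ).filter (fun p => (plaquetteEdges p ∩ B₂).Nonempty)).biUnion plaquetteEdges).card *
          ((|N * β| * Real.exp (|N * β| * (2 * N * ((plaquettesTouching Λ).filter (fun p => (plaquetteEdges p ∩ B₁).Nonempty)).card)) *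
              (8 * (N : ℝ) ^ 4 * ((plaquettesTouching Λ).filter (fun p => (plaquetteEdges p ∩ B₁).Nonempty)).card)) *
            (|N * β| * Real.exp (|N * β| * (2 * N * ((plaquettesTouching Λ).filter (fun p => (plaquetteEdges p ∩ B₂).Nonempty)).card)) *
              (8 * (N : ℝ) ^ 4 * ((plaquettesTouching Λ).filter (fun p => (plaquetteEdges p ∩ B₂).Nonempty)).card))) *
          (Real.exp (-Real.log (max ρ (1 / 2))) * Real.exp (-(-Real.log (max ρ (1 / 2)) / max 1 (0 : ℝ)) * setDistEdges
            (((plaquettesTouching Λ).filter (fun p => (plaquetteEdges p ∩ B₁).Nonempty)).biUnion plaquetteEdges)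
            (((plaquettesTouching Λ).filter (fun p => (plaquetteEdges p ∩ B₂).Nonempty)).biUnion plaquetteEdges)))) := by
  set P₁ := (plaquettesTouching Λ).filter (fun p => (plaquetteEdges p ∩ B₁).Nonempty) with hP₁
  set P₂ := (plaquettesTouching Λ).filter (fun p => (plaquetteEdges p ∩ B₂).Nonempty) with hP₂
  set b : ℝ := N * β with hbdef
  have hK : ∀ (P : Finset (ZdPlaquette d)), 0 ≤ |b| * Real.exp (|b| * (2 * N * P.card)) * (8 * (N : ℝ) ^ 4 * P.card) :=
    fun P => by positivity
  set K₁ : ℝ≥0 := (|b| * Real.exp (|b| * (2 * N * P₁.card)) * (8 * (N : ℝ) ^ 4 * P₁.card)).toNNReal with hK₁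
  set K₂ : ℝ≥0 := (|b| * Real.exp (|b| * (2 * N * P₂.card)) * (8 * (N : ℝ) ^ 4 * P₂.card)).toNNReal with hK₂
  have hK₁c : (K₁ : ℝ) = |b| * Real.exp (|b| * (2 * N * P₁.card)) * (8 * (N : ℝ) ^ 4 * P₁.card) := by
    rw [hK₁, Real.coe_toNNReal _ (hK P₁)]
  have hK₂c : (K₂ : ℝ) = |b| * Real.exp (|b| * (2 * N * P₂.card)) * (8 * (N : ℝ) ^ 4 * P₂.card) := by
    rw [hK₂, Real.coe_toNNReal _ (hK P₂)]
  have hF₁ := suN_isLipschitzCylinder_boundaryFactor (N := N) b Λ B₁ hη₁ (K := K₁) (by rw [hK₁c])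
  have hF₂ := suN_isLipschitzCylinder_boundaryFactor (N := N) b Λ B₂ hη₂ (K := K₂) (by rw [hK₂c])
  -- the Bakry–Émery kernel clustering at the Wilson point (zero member of the tier-1 ball, range `0`)
  classical
  have hmem : MemBallZd (N := N) (0 : ℝ) 0 0 (0 : Potential (ZdEdge d) (SUN N)) (fun _ => (∅ : Finset (Finset (ZdEdge d)))) :=
    memBallZd_zero le_rfl le_rfl fun _ _ h => by simp at h
  have hρ' : 6 * ((d : ℝ) - 1) * |β| * Real.exp 0 / (1 / 2 - |β| * (2 * ((d : ℝ) - 1))) +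
      Real.exp (0 / 2) * 0 / Real.sqrt ((N : ℝ) * (1 / 2 - |β| * (2 * ((d : ℝ) - 1)))) ≤ ρ := by
    simpa using hρ
  have hcov := suN_kernel_covariance_decay_bakryEmery hd hN hb hρ' hρ1 hmem Λ η hF₁ hF₂
  rw [perturbedYM_zero] at hcov
  -- the door
  have hD₁ := fun ζ : ↥Λ → SUN N => suN_abs_boundaryShift_le (N := N) Λ B₁ hη₁ ζ
  have hD₂ := fun ζ : ↥Λ → SUN N => suN_abs_boundaryShift_le (N := N) Λ B₂ hη₂ ζ
  have key := abs_mixedDifference_log_normaliser_le (fundamentalRep (Fin N)) (continuous_fundamentalRep (Fin N)) b Λ B₁ B₂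
    hη₁ hη₂ h₁₂B₁ h₁₂B₂ h₁₂ hsep hD₁ hD₂ hcov
  refine key.trans (le_of_eq ?_)
  rw [hK₁c, hK₂c]

end BoundaryFreeEnergy

end Summit.Ventures.YMGap.RobustBall

end
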